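import Summits.NavierStokesRegularity.NavierStokesRegularity.Theorems.PalasekTowerBreakdownEpisodeBaseTolerant
import Summits.NavierStokesRegularity.FluidComputer.PalasekTowerGermHostCompanion

/-!
# `EpisodeBase` BY NAME for COMPOSITE designs: a certified carrier plus a far companion

Cell `ns-blowup`, seat `ns-blowup-ecbridge-3` (g4); GROUP C «BRIDGE SUPPORT» of the route
`PalasekTowerBreakdown`, crux `EpisodeBase` (item stmt-NavierStokesRegularity-19179, R2 of record; line
of record `slot`: ONE stub, `∃ U ρ c₄ (h : Germ.LevelZeroData U ρ) …, PushedLevelWitness (h.schedule c₄ …)`).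
Sequel of `PalasekTowerBreakdownEpisodeBaseTolerant.lean` over the COMPANION RULE of
`FluidComputer/PalasekTowerGermHostCompanion.lean` (GermHost XIX, with the sharp far-field bound of
XVIII): a design `U₁ + U₂` made of a slot-certified CARRIER `U₁` (`tsupport U₁ ⊆ B̄(0, ρ₁)`; readouts and
anchor test) and a smooth divergence-free COMPANION `U₂` supported in `B̄(0, ρ)` outside `B̄(0, ρ₁ + d)`,
`d ≥ 1/N₀`, everywhere slower than `Y₀` — the would-be amplifier of the episode — is slot-certified again
as soon as the companion's ENERGY obeys `(3/(2πd⁴)) ∫‖U₂‖² ≤ (c₄ − c') Y₀ / 8` (tolerant slot at push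
`c₄` from a tolerant carrier at push `c'`), resp. `(3/(2πd⁴)) Y₀ ∫‖U₂‖² < rate(U₁)` (STRICT slot, the
registered line's class). LABEL: E–C typing (KERNEL, proofs only, by name). WHAT THIS IS NOT: not
Navier–Stokes evidence — host preparation of PRESCRIBED composite profiles and conditionals whose
hypothesis is the OPEN episode of the composite design; nothing about any flow after `τ₀`, `RungG 1` or
blow-up. HELPER for 19179 (`--supports`), closes nothing.

* (FluidComputer, `Germ.LevelZeroData.add_far_rate`, not restated here): carrier in the STRICT slot +
  far companion under the rate budget ⇒ the composite is in the STRICT slot — an admissible `U` of the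
  registered stub;
* `palasekTowerBreakdown_hostPreparationD_companion`: tolerant carrier + far companion under the energy
  budget ⇒ `HostPreparationD (HostClass.exact S⋆(U₁ + U₂, c₄))` — no further hypothesis;
* `palasekTowerBreakdown_episodeBase_of_companion_levelWitness`: `EpisodeBase ⇐ S⋆(U₁ + U₂, c₄).LevelWitness 1 0`
  — ONE classical finite-energy flow of the composite's pushed germ schedule from rest with the three
  level-`1` floors at `τ₁` below `(5/3)Y₁`;
* `palasekTowerBreakdown_episodeBase_of_companion_firstEpisodeD`: `EpisodeBase ⇐ FirstEpisodeD (exact S⋆(U₁ + U₂, c₄))`.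

References: S. Palasek, arXiv:2605.13827 §3.3, §4 (Step 2) [cite: Palasek2026ElementaryModel, §4];
D. Gilbarg, N. S. Trudinger, *Elliptic PDE of Second Order* (2001), Lemma 4.1 [cite: GilbargTrudinger2001, Lemma 4.1];
H. Sohr, *The Navier–Stokes Equations* (2001), Ch. V Thm. 1.5.1 [cite: Sohr2001, Ch. V Thm. 1.5.1].
-/

noncomputable section

-- `Summit.<Summit>.<Problem>` is the tree's mandated summit-side namespace (CONVENTIONS §2); for this
-- single-conjunct summit the two coincide, so the duplicate is deliberate.
set_option linter.dupNamespace false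

namespace Summit.NavierStokesRegularity.NavierStokesRegularity.Theorems

open Set Function Metric MeasureTheory Real
open scoped ContDiff
open Summit.NavierStokesRegularity.FluidComputer.PalasekTowerClayBridge
open Summit.NavierStokesRegularity.FluidComputer.PalasekTowerClayBridge.Germ
open Literature.Analysis.FluidPDE

variable {U₁ U₂ : EuclideanSpace ℝ (Fin 3) → EuclideanSpace ℝ (Fin 3)} {ρ₁ ρ d : ℝ}
  (h₂s : ContDiff ℝ ∞ U₂) (hdiv₂ : VectorCalculus.IsDivFree U₂)
  (h₂supp : tsupport U₂ ⊆ closedBall 0 ρ) (hρ : ρ₁ ≤ ρ)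
  (hfar : ∀ y ∈ tsupport U₂, ρ₁ + d < ‖y‖) (hdN : 1 / TowerRates.wide.N 0 ≤ d)
  (h₂lt : ∀ x, ‖U₂ x‖ < TowerRates.wide.Y 0)

include h₂s hdiv₂ h₂supp hρ hfar hdN h₂lt

variable {c' c₄ : ℝ}

/-- **HOST PREPARATION FOR EVERY CARRIER-PLUS-COMPANION DESIGN** (first conjunct of the R2 witness, no
further hypothesis): tolerant carrier at push `c'`, companion energy `(3/(2πd⁴)) ∫‖U₂‖² ≤ (c₄ − c') Y₀/8`,
`c₄ ∈ (0, 1]` ⇒ the pushed germ schedule `S⋆(U₁ + U₂, c₄)` is prepared in its singleton class.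
[cite: Palasek2026ElementaryModel, §3.3] -/
theorem palasekTowerBreakdown_hostPreparationD_companion (h₁ : LevelZeroDataTol c' U₁ ρ₁)
    (hbudget : 3 / (2 * π * d ^ 4) * ∫ x, ‖U₂ x‖ ^ 2 ≤ (c₄ - c') * TowerRates.wide.Y 0 / 8)
    (hc₄ : 0 < c₄) (hc₄' : c₄ ≤ 1) :
    HostPreparationD (HostClass.exact
      ((h₁.add_far h₂s hdiv₂ h₂supp hρ hfar hdN h₂lt hbudget).host hc₄ hc₄')) :=
  h₁.hostPreparationD_host_add_far h₂s hdiv₂ h₂supp hρ hfar hdN h₂lt hbudget hc₄ hc₄'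

/-- **`EpisodeBase` from ONE LEVEL WITNESS of a carrier-plus-companion design** (no re-push): a
classical finite-energy flow of `S⋆(U₁ + U₂, c₄)`'s forced system from rest reaching `τ₁` below `(5/3)Y₁`
on the window with the three level-`1` floors at `τ₁`. [cite: Sohr2001, Ch. V Thm. 1.5.1] -/
theorem palasekTowerBreakdown_episodeBase_of_companion_levelWitness (h₁ : LevelZeroDataTol c' U₁ ρ₁)
    (hbudget : 3 / (2 * π * d ^ 4) * ∫ x, ‖U₂ x‖ ^ 2 ≤ (c₄ - c') * TowerRates.wide.Y 0 / 8)
    (hc₄ : 0 < c₄) (hc₄' : c₄ ≤ 1)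
    (hW : ((h₁.add_far h₂s hdiv₂ h₂supp hρ hfar hdN h₂lt hbudget).host hc₄ hc₄').LevelWitness 1 0) :
    Summit.NavierStokesRegularity.NavierStokesRegularity.Theses.PalasekTowerBreakdown.EpisodeBase :=
  palasekTowerBreakdown_episodeBase_of_tolerant_levelWitness _ hc₄ hc₄' hW

/-- **`EpisodeBase` from the EPISODE of a carrier-plus-companion design.** [cite: Palasek2026ElementaryModel, §4] -/
theorem palasekTowerBreakdown_episodeBase_of_companion_firstEpisodeD (h₁ : LevelZeroDataTol c' U₁ ρ₁)
    (hbudget : 3 / (2 * π * d ^ 4) * ∫ x, ‖U₂ x‖ ^ 2 ≤ (c₄ - c') * TowerRates.wide.Y 0 / 8)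
    (hc₄ : 0 < c₄) (hc₄' : c₄ ≤ 1)
    (hF : FirstEpisodeD (HostClass.exact
      ((h₁.add_far h₂s hdiv₂ h₂supp hρ hfar hdN h₂lt hbudget).host hc₄ hc₄'))) :
    Summit.NavierStokesRegularity.NavierStokesRegularity.Theses.PalasekTowerBreakdown.EpisodeBase :=
  palasekTowerBreakdown_episodeBase_of_tolerant_firstEpisodeD _ hc₄ hc₄' hF

end Summit.NavierStokesRegularity.NavierStokesRegularity.Theorems

end
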